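/-
Copyright (c) 2026 the pub-hodgecm-mathlib formalisation cell (harness21).  Prover seat hodgecm-mathlib-F0P3a-p01 (g18): road «S3-ram» (LEAD F0P3a-plan (g13);
owner F0P3a-p06), (Cnt2′) route B (chair F0P3a-p07 (g15) RULING (13)), organ (4c-ii) «A-EVEN TUBE EXCLUSION BY THE ISOTROPIC KERNEL», algebra half; 2026-09-02.
-/
import Literature.NumberTheory.Automorphic.UnitaryLatticeTreeBlockRootRegionAxis        -- ★ p849125 (this seat): `pairing_smul_smul`; brings `pairing`, `unitaryGroupOfForm`, `v_lt_one_iff`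
import HarnessLib

/-!
# The hyperbolic hermitian plane `Φ₂ = !![0,1;1,0]` over a valued field: the unitarity dictionary, the skew-adjoint identity of the centred element, and the
# isotropic-kernel contradiction (Jacobowitz 1962 §4; Labesse–Langlands 1979 §2)

Topic `NumberTheory/Automorphic`; namespace `Literature.NumberTheory.Automorphic.UnitaryLatticeTree`.  THEOREMS ONLY (no definition, no instance, no notation, no named fact,
no `sorry`); kernel lane `--supports stmt-HodgeConjecture-24833`; datum-free (`K` with `Valued K ℤᵐ⁰`, any `σ : K →+* K`).  Cell `pub/hodgecm-mathlib` (D-0151), crux H413; road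
«S3-ram» (count-neutral); (Cnt2′) route B, organ **(4c-ii)** (the regime-A-even twin of ★ p849125 (4c)), ALGEBRA HALF — consumed by `UnitaryLatticeTreeBlockRootRegionAxisTop`
(the lattice half: at the top root level the root region of the hyperbolic block literal lies on the axis).

THE MATHEMATICS.  `⟨x, y⟩ = σ(x₀)y₁ + σ(x₁)y₀` (§1).  For `γ ∈ U(σ, Φ₂)` with `d = det γ`, Cramer on `ᵗσ(γ)Φ₂γ = Φ₂` gives the DICTIONARY `σ(γ₀₀)d = γ₀₀`, `σ(γ₁₁)d = γ₁₁`,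
`σ(γ₀₁)d = −γ₀₁`, `σ(γ₁₀)d = −γ₁₀` (§1 `sigma_apply_mul_det_of_unitary_two`), hence `σ(½tr γ)·d = ½tr γ` and, with `γ⁻¹ = d⁻¹(tr γ·1 − γ)`, the ADJOINT IDENTITY for the centred
element `E := γ − ½tr γ·1`: **`⟨E a, v⟩ = −d⁻¹·⟨a, E v⟩`** (§1 `pairing_sub_smul_mulVec_eq_neg_of_unitary_two`) — `E` is `Φ₂`-skew up to a unit; with Cayley–Hamilton
`E² = (¼tr² − det)·1` (§1) it maps isotropic vectors to isotropic vectors.  §2 `false_of_isotropic_orthogonal_unit`: in `(𝒪², Φ₂)` no `x` with a unit coordinate is residually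
isotropic (`|⟨x,x⟩| ≤ |ϖ|`) AND residually orthogonal (`|⟨x,y⟩| ≤ |ϖ|`) to a unit-norm `y` (`|⟨y,y⟩| = 1`): if `x̄ ∧ ȳ ≠ 0` the identities `σ(x₁)(x₀y₁ − x₁y₀) = y₁⟨x,x⟩ − x₁⟨x,y⟩`,
`σ(x₀)(x₀y₁ − x₁y₀) = x₀⟨x,y⟩ − y₀⟨x,x⟩` force `x̄ = 0`; if `x̄ ∧ ȳ = 0` then `x_{i₀}y = y_{i₀}x + r`, `r ∈ ϖ𝒪²`, makes `y` residually isotropic.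
HONEST LABEL: HC_CM is proved only modulo the 2 remaining named inputs (hLiu418 24832, h413 24833) until rung 0 closes; nothing printed is asserted here (elementary `2 × 2`
algebra over a valued field); «S3-ram» has no books consequence.

## References
* [Jacobowitz1962] R. Jacobowitz, *Hermitian forms over local fields*, Amer. J. Math. 84 (1962), §4 (hermitian pairings, adjoints, hyperbolic planes).
* [LabesseLanglands1979] J.-P. Labesse, R. P. Langlands, *L-indistinguishability for SL(2)*, Canad. J. Math. 31 (1979), §2 Lemma 2.1 p. 8 (the centred element of a torus).
* [BruhatTits1972] F. Bruhat, J. Tits, *Groupes réductifs sur un corps local I*, Publ. Math. IHÉS 41 (1972), §10 (lattices in a hermitian space).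
* [Rogawski1990] J. D. Rogawski, *Automorphic Representations of Unitary Groups in Three Variables*, Ann. of Math. Stud. 123 (1990), §1.9 p. 8, §4.8 Case (a) p. 53.
-/

set_option autoImplicit false

noncomputable section

open scoped Valued WithZero Matrix MatrixGroups

namespace Literature.NumberTheory.Automorphic.UnitaryLatticeTree

open Literature.NumberTheory.Automorphic Literature.NumberTheory.Automorphic.HermitianLattice Literature.NumberTheory.Rogawski1990

variable {K : Type*} [Field K] [Valued K ℤᵐ⁰]

/-! ## §1 The hyperbolic plane `Φ₂ = !![0,1;1,0]`: pairing, unitarity dictionary, adjoint identity -/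

omit [Valued K ℤᵐ⁰] in
/-- The pairing of the hyperbolic plane: `⟨x, y⟩ = σ(x₀)·y₁ + σ(x₁)·y₀`. [cite: Jacobowitz1962, §4] -/
theorem pairing_antidiag_two_apply (σ : K →+* K) (x y : Fin 2 → K) :
    pairing σ (!![(0 : K), 1; 1, 0] : Matrix (Fin 2) (Fin 2) K) x y = σ (x 0) * y 1 + σ (x 1) * y 0 := by
  simp [pairing_apply, Fin.sum_univ_two]

omit [Valued K ℤᵐ⁰] in
/-- The standard basis vectors of the hyperbolic plane are ISOTROPIC. [cite: Jacobowitz1962, §4] -/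
theorem pairing_antidiag_two_single_self (σ : K →+* K) (j : Fin 2) :
    pairing σ (!![(0 : K), 1; 1, 0] : Matrix (Fin 2) (Fin 2) K) (Pi.single j 1) (Pi.single j 1) = 0 := by
  rw [pairing_antidiag_two_apply]
  fin_cases j <;> simp

/-- The pairing of the hyperbolic plane is bounded entrywise: `|x_i| ≤ s`, `|y_i| ≤ t` ⇒ `|⟨x, y⟩| ≤ s·t`. [cite: Jacobowitz1962, §4] -/
theorem v_pairing_antidiag_two_le {σ : K →+* K} (hvσ : ∀ a, Valued.v (σ a) = Valued.v a) {x y : Fin 2 → K} {s t : ℤᵐ⁰}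
    (hx : ∀ i, Valued.v (x i) ≤ s) (hy : ∀ i, Valued.v (y i) ≤ t) :
    Valued.v (pairing σ (!![(0 : K), 1; 1, 0] : Matrix (Fin 2) (Fin 2) K) x y) ≤ s * t := by
  rw [pairing_antidiag_two_apply]
  refine (Valuation.map_add _ _ _).trans (max_le ?_ ?_)
  · rw [map_mul, hvσ]; exact mul_le_mul' (hx 0) (hy 1)
  · rw [map_mul, hvσ]; exact mul_le_mul' (hx 1) (hy 0)

omit [Valued K ℤᵐ⁰] in
/-- **UNITARITY DICTIONARY IN THE HYPERBOLIC FRAME**: for `γ ∈ U(σ, Φ₂)` with `d = det γ`: `σ(γ₀₀)·d = γ₀₀`, `σ(γ₀₁)·d = −γ₀₁`, `σ(γ₁₀)·d = −γ₁₀`, `σ(γ₁₁)·d = γ₁₁`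
(Cramer on the four relations `ᵗσ(γ)Φ₂γ = Φ₂`). [cite: Rogawski1990, §1.9 p. 8] [cite: Jacobowitz1962, §4] -/
theorem sigma_apply_mul_det_of_unitary_two (σ : K →+* K) {γ : GL (Fin 2) K}
    (hU : γ ∈ unitaryGroupOfForm σ (!![(0 : K), 1; 1, 0] : Matrix (Fin 2) (Fin 2) K)) :
    σ ((γ : Matrix (Fin 2) (Fin 2) K) 0 0) * (γ : Matrix (Fin 2) (Fin 2) K).det = (γ : Matrix (Fin 2) (Fin 2) K) 0 0 ∧
    σ ((γ : Matrix (Fin 2) (Fin 2) K) 0 1) * (γ : Matrix (Fin 2) (Fin 2) K).det = -(γ : Matrix (Fin 2) (Fin 2) K) 0 1 ∧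
    σ ((γ : Matrix (Fin 2) (Fin 2) K) 1 0) * (γ : Matrix (Fin 2) (Fin 2) K).det = -(γ : Matrix (Fin 2) (Fin 2) K) 1 0 ∧
    σ ((γ : Matrix (Fin 2) (Fin 2) K) 1 1) * (γ : Matrix (Fin 2) (Fin 2) K).det = (γ : Matrix (Fin 2) (Fin 2) K) 1 1 := by
  have h : (((γ : Matrix (Fin 2) (Fin 2) K)).map σ)ᵀ * (!![(0 : K), 1; 1, 0] : Matrix (Fin 2) (Fin 2) K) * (γ : Matrix (Fin 2) (Fin 2) K) = !![(0 : K), 1; 1, 0] := hU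
  have e00 := congrFun (congrFun h 0) 0
  have e01 := congrFun (congrFun h 0) 1
  have e10 := congrFun (congrFun h 1) 0
  have e11 := congrFun (congrFun h 1) 1
  simp [Matrix.mul_apply, Fin.sum_univ_two] at e00 e01 e10 e11
  rw [Matrix.det_fin_two]
  refine ⟨?_, ?_, ?_, ?_⟩
  · linear_combination (γ : Matrix (Fin 2) (Fin 2) K) 0 0 * e01 - (γ : Matrix (Fin 2) (Fin 2) K) 0 1 * e00
  · linear_combination (γ : Matrix (Fin 2) (Fin 2) K) 0 0 * e11 - (γ : Matrix (Fin 2) (Fin 2) K) 0 1 * e10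
  · linear_combination (γ : Matrix (Fin 2) (Fin 2) K) 1 1 * e00 - (γ : Matrix (Fin 2) (Fin 2) K) 1 0 * e01
  · linear_combination (γ : Matrix (Fin 2) (Fin 2) K) 1 1 * e10 - (γ : Matrix (Fin 2) (Fin 2) K) 1 0 * e11

omit [Valued K ℤᵐ⁰] in
/-- Entries of `(A − c·1)·a` for a `2 × 2` matrix. [cite: Jacobowitz1962, §4] -/
theorem sub_smul_one_mulVec_fin_two (A : Matrix (Fin 2) (Fin 2) K) (c : K) (a : Fin 2 → K) :
    (A - c • (1 : Matrix (Fin 2) (Fin 2) K)) *ᵥ a = ![(A 0 0 - c) * a 0 + A 0 1 * a 1, A 1 0 * a 0 + (A 1 1 - c) * a 1] := by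
  ext i
  fin_cases i <;> simp [Matrix.mulVec, dotProduct, Fin.sum_univ_two, Matrix.one_apply]

omit [Valued K ℤᵐ⁰] in
/-- **THE ADJOINT IDENTITY**: for `γ ∈ U(σ, Φ₂)`, `E := γ − ½tr γ·1` is `Φ₂`-skew up to the unit `det γ`: `⟨E a, v⟩ = −(det γ)⁻¹·⟨a, E v⟩` (`σ(½tr γ)·det γ = ½tr γ` and
`γ⁻¹ = det⁻¹·(tr γ·1 − γ)`). [cite: Jacobowitz1962, §4] [cite: LabesseLanglands1979, §2 Lemma 2.1 p. 8] -/
theorem pairing_sub_smul_mulVec_eq_neg_of_unitary_two (σ : K →+* K) (h2 : (2 : K) ≠ 0) {γ : GL (Fin 2) K}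
    (hU : γ ∈ unitaryGroupOfForm σ (!![(0 : K), 1; 1, 0] : Matrix (Fin 2) (Fin 2) K)) (a v : Fin 2 → K) :
    pairing σ (!![(0 : K), 1; 1, 0] : Matrix (Fin 2) (Fin 2) K)
        ((((γ : Matrix (Fin 2) (Fin 2) K) - ((γ : Matrix (Fin 2) (Fin 2) K).trace / 2) • (1 : Matrix (Fin 2) (Fin 2) K))) *ᵥ a) v =
      -((γ : Matrix (Fin 2) (Fin 2) K).det)⁻¹ *
        pairing σ (!![(0 : K), 1; 1, 0] : Matrix (Fin 2) (Fin 2) K) a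
          ((((γ : Matrix (Fin 2) (Fin 2) K) - ((γ : Matrix (Fin 2) (Fin 2) K).trace / 2) • (1 : Matrix (Fin 2) (Fin 2) K))) *ᵥ v) := by
  obtain ⟨h00, h01, h10, h11⟩ := sigma_apply_mul_det_of_unitary_two σ hU
  have hd : (γ : Matrix (Fin 2) (Fin 2) K).det ≠ 0 := (Matrix.isUnits_det_units γ).ne_zero
  set d := (γ : Matrix (Fin 2) (Fin 2) K).det with hddef
  have hσ2 : σ 2 = 2 := map_ofNat σ 2
  have g00 : σ ((γ : Matrix (Fin 2) (Fin 2) K) 0 0) = (γ : Matrix (Fin 2) (Fin 2) K) 0 0 / d := by rw [eq_div_iff hd]; exact h00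
  have g01 : σ ((γ : Matrix (Fin 2) (Fin 2) K) 0 1) = -(γ : Matrix (Fin 2) (Fin 2) K) 0 1 / d := by rw [eq_div_iff hd]; exact h01
  have g10 : σ ((γ : Matrix (Fin 2) (Fin 2) K) 1 0) = -(γ : Matrix (Fin 2) (Fin 2) K) 1 0 / d := by rw [eq_div_iff hd]; exact h10
  have g11 : σ ((γ : Matrix (Fin 2) (Fin 2) K) 1 1) = (γ : Matrix (Fin 2) (Fin 2) K) 1 1 / d := by rw [eq_div_iff hd]; exact h11
  rw [hddef, Matrix.det_fin_two] at hd
  rw [sub_smul_one_mulVec_fin_two, sub_smul_one_mulVec_fin_two, pairing_antidiag_two_apply, pairing_antidiag_two_apply]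
  simp only [Matrix.cons_val_zero, Matrix.cons_val_one, Matrix.trace_fin_two, map_add, map_sub, map_mul, map_div₀, hσ2,
    g00, g01, g10, g11, hddef, Matrix.det_fin_two]
  field_simp
  ring

omit [Valued K ℤᵐ⁰] in
/-- Cayley–Hamilton for the centred matrix: `(A − ½trA·1)² = (¼tr²A − det A)·1` (`2 ≠ 0`). [cite: LabesseLanglands1979, §2 Lemma 2.1 p. 8] -/
theorem sub_half_trace_smul_one_mul_self (h2 : (2 : K) ≠ 0) (A : Matrix (Fin 2) (Fin 2) K) :
    (A - (A.trace / 2) • (1 : Matrix (Fin 2) (Fin 2) K)) * (A - (A.trace / 2) • (1 : Matrix (Fin 2) (Fin 2) K)) =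
      ((A.trace / 2) ^ 2 - A.det) • (1 : Matrix (Fin 2) (Fin 2) K) := by
  ext i j
  fin_cases i <;> fin_cases j <;>
    simp [Matrix.mul_apply, Fin.sum_univ_two, Matrix.one_apply, Matrix.trace_fin_two, Matrix.det_fin_two] <;> field_simp <;> ring

/-! ## §2 A residually isotropic integral vector orthogonal to a unit-norm vector is residually zero -/

omit [Valued K ℤᵐ⁰] in
/-- The coordinates of `x_{i₀}·y − y_{i₀}·x` are `0` or `±(x₀y₁ − x₁y₀)`. [cite: Jacobowitz1962, §4] -/
theorem smul_sub_smul_apply_eq_or (x y : Fin 2 → K) (i₀ k : Fin 2) :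
    (x i₀ • y - y i₀ • x) k = 0 ∨ (x i₀ • y - y i₀ • x) k = x 0 * y 1 - x 1 * y 0 ∨ (x i₀ • y - y i₀ • x) k = -(x 0 * y 1 - x 1 * y 0) := by
  fin_cases i₀ <;> fin_cases k
  · left; simp [mul_comm]
  · right; left; simp [mul_comm]
  · right; right; simp; ring
  · left; simp [mul_comm]

/-- **THE ISOTROPIC-KERNEL CONTRADICTION.**  In the hyperbolic plane `(𝒪², Φ₂)`: there is NO pair `x, y ∈ 𝒪²` with `x` having a UNIT coordinate, `|⟨x, x⟩| ≤ |ϖ|` (residually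
isotropic), `|⟨x, y⟩| ≤ |ϖ|` (residually orthogonal) and `|⟨y, y⟩| = 1` (unit norm).  For if `x̄ ∧ ȳ ≠ 0` then `σ(x₁)·(x₀y₁ − x₁y₀) = y₁⟨x,x⟩ − x₁⟨x,y⟩` and its twin put `x̄ = 0`;
and if `x̄ ∧ ȳ = 0` then `x_{i₀}·y = y_{i₀}·x + r` with `r ∈ ϖ𝒪²` makes `y` residually isotropic. [cite: Jacobowitz1962, §4] [cite: BruhatTits1972, §10] -/
theorem false_of_isotropic_orthogonal_unit {σ : K →+* K} (hvσ : ∀ a, Valued.v (σ a) = Valued.v a) {ϖ : K} (hϖ : Valued.v ϖ = WithZero.exp (-1 : ℤ))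
    {x y : Fin 2 → K} (hx : ∀ i, Valued.v (x i) ≤ 1) {i₀ : Fin 2} (hxi : Valued.v (x i₀) = 1) (hy : ∀ i, Valued.v (y i) ≤ 1)
    (hxx : Valued.v (pairing σ (!![(0 : K), 1; 1, 0] : Matrix (Fin 2) (Fin 2) K) x x) ≤ Valued.v ϖ)
    (hxy : Valued.v (pairing σ (!![(0 : K), 1; 1, 0] : Matrix (Fin 2) (Fin 2) K) x y) ≤ Valued.v ϖ)
    (hyy : Valued.v (pairing σ (!![(0 : K), 1; 1, 0] : Matrix (Fin 2) (Fin 2) K) y y) = 1) : False := by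
  have hϖ1 : Valued.v ϖ < 1 := by rw [hϖ, ← WithZero.exp_zero]; exact WithZero.exp_lt_exp.2 (by norm_num)
  set D : K := x 0 * y 1 - x 1 * y 0 with hDdef
  have hD1 : Valued.v D ≤ 1 := by
    refine (Valuation.map_sub _ _ _).trans (max_le ?_ ?_)
    · rw [map_mul]; exact mul_le_one' (hx 0) (hy 1)
    · rw [map_mul]; exact mul_le_one' (hx 1) (hy 0)
  by_cases hD : Valued.v D = 1
  · -- `x̄ ∧ ȳ ≠ 0`: both coordinates of `x` are residually zero
    have key : ∀ i, Valued.v (x i) ≤ Valued.v ϖ := by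
      have e1 : σ (x 1) * D = y 1 * pairing σ (!![(0 : K), 1; 1, 0] : Matrix (Fin 2) (Fin 2) K) x x -
          x 1 * pairing σ (!![(0 : K), 1; 1, 0] : Matrix (Fin 2) (Fin 2) K) x y := by
        rw [pairing_antidiag_two_apply, pairing_antidiag_two_apply, hDdef]; ring
      have e0 : σ (x 0) * D = x 0 * pairing σ (!![(0 : K), 1; 1, 0] : Matrix (Fin 2) (Fin 2) K) x y -
          y 0 * pairing σ (!![(0 : K), 1; 1, 0] : Matrix (Fin 2) (Fin 2) K) x x := by
        rw [pairing_antidiag_two_apply, pairing_antidiag_two_apply, hDdef]; ring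
      have b1 : Valued.v (x 1) ≤ Valued.v ϖ := by
        have h := congrArg Valued.v e1
        rw [map_mul, hvσ, hD, mul_one] at h
        rw [h]
        refine (Valuation.map_sub _ _ _).trans (max_le ?_ ?_)
        · rw [map_mul]; exact mul_le_of_le_one_of_le (hy 1) hxx
        · rw [map_mul]; exact mul_le_of_le_one_of_le (hx 1) hxy
      have b0 : Valued.v (x 0) ≤ Valued.v ϖ := by
        have h := congrArg Valued.v e0
        rw [map_mul, hvσ, hD, mul_one] at h
        rw [h]
        refine (Valuation.map_sub _ _ _).trans (max_le ?_ ?_)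
        · rw [map_mul]; exact mul_le_of_le_one_of_le (hx 0) hxy
        · rw [map_mul]; exact mul_le_of_le_one_of_le (hy 0) hxx
      intro i; fin_cases i
      · exact b0
      · exact b1
    exact absurd ((key i₀).trans_lt hϖ1) (not_lt.2 hxi.ge)
  · -- `x̄ ∧ ȳ = 0`: `x_{i₀}·y = y_{i₀}·x + r` with `r ∈ ϖ𝒪²`, so `y` is residually isotropic
    have hDϖ : Valued.v D ≤ Valued.v ϖ := by rw [hϖ]; exact (v_lt_one_iff D).1 (lt_of_le_of_ne hD1 hD)
    set r : Fin 2 → K := x i₀ • y - y i₀ • x with hrdef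
    have hr : ∀ k, Valued.v (r k) ≤ Valued.v ϖ := by
      intro k
      show Valued.v ((x i₀ • y - y i₀ • x) k) ≤ Valued.v ϖ
      rcases smul_sub_smul_apply_eq_or x y i₀ k with h0 | hD' | hD'
      · rw [h0, map_zero]; exact zero_le
      · rw [hD']; exact hDϖ
      · rw [hD', Valuation.map_neg]; exact hDϖ
    have hdec : x i₀ • y = y i₀ • x + r := by rw [hrdef]; abel
    -- `|⟨x_{i₀}y, x_{i₀}y⟩| = 1`
    have hbig : Valued.v (pairing σ (!![(0 : K), 1; 1, 0] : Matrix (Fin 2) (Fin 2) K) (x i₀ • y) (x i₀ • y)) = 1 := by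
      rw [pairing_smul_smul, map_mul, map_mul, hvσ, hxi, hyy, one_mul, one_mul]
    -- but `⟨y_{i₀}x + r, y_{i₀}x + r⟩` is small
    have hsmall : Valued.v (pairing σ (!![(0 : K), 1; 1, 0] : Matrix (Fin 2) (Fin 2) K) (y i₀ • x + r) (y i₀ • x + r)) ≤ Valued.v ϖ := by
      have hyx : ∀ i, Valued.v ((y i₀ • x) i) ≤ 1 := fun i => by
        rw [Pi.smul_apply, smul_eq_mul, map_mul]; exact mul_le_one' (hy i₀) (hx i)
      simp only [map_add, LinearMap.add_apply]
      refine (Valuation.map_add _ _ _).trans (max_le ((Valuation.map_add _ _ _).trans (max_le ?_ ?_)) ((Valuation.map_add _ _ _).trans (max_le ?_ ?_)))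
      · rw [pairing_smul_smul, map_mul, map_mul, hvσ]
        exact mul_le_of_le_one_of_le (hy i₀) (mul_le_of_le_one_of_le (hy i₀) hxx)
      · exact (v_pairing_antidiag_two_le hvσ hr hyx).trans (le_of_eq (mul_one _))
      · exact (v_pairing_antidiag_two_le hvσ hyx hr).trans (le_of_eq (one_mul _))
      · exact (v_pairing_antidiag_two_le hvσ hr hr).trans (mul_le_of_le_one_of_le hϖ1.le le_rfl)
    rw [hdec] at hbig
    exact absurd (hbig.symm.trans_le hsmall) (not_le.2 hϖ1)

end Literature.NumberTheory.Automorphic.UnitaryLatticeTree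

end
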